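import Summits.ResolutionOfSingularities.ResolutionOfSingularities.Theorems.EquisingularLiftEquisingularLiftNatCubicSurfaceOrdinaryPoints
import Summits.ResolutionOfSingularities.ResolutionOfSingularities.Theorems.EquisingularLiftEquisingularLiftNatSubmaxLinNResidual
import HarnessLib

/-!
# [OURS] The residual of `EquisingularLiftNat` (stmt-…-20038, every `n`) RE-CUT BY NAME off the cubic surfaces with only ordinary singular points

[OURS · leafhand-res-equisingularlift-8 g0, 2026-08-31; cell `pub/decomp-res`; item stmt-…-20038] AI-produced, weaker than expert review; NOT a statement
of any manuscript; nothing here proves resolution of singularities in positive characteristic.  DEF-FREE; no `sorry`; standard axioms; ZERO named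
hypotheses; pure reduction over ✓ `SubmaxLinN.equisingularLiftNat_of_forall_elnatO_off_submaxLinN` (p823304) and ✓ `CubicNodes.elNatAt_of_cubic_ordinary`
(this generation).

* ★ `CubicNodes.equisingularLiftNat_of_forall_elnatO_off_submaxLinN_cubicOrdinary` — `Theses.EquisingularLift.EquisingularLiftNat` holds BY NAME as soon
  as `ELNatConclusionO` is known for the non-regular `H = V₊(F)` (`F` a prime form of degree `e ≥ 3`, `n ≥ 3`) with no submaximal codimension-2 linear
  subspace which, IF `n = 3` and `e = 3`, carries a singular vector `b` (`b_{c₀} = 1`) admitting no ordinary datum (translated chart never `Φ + Ψ`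
  with `Φ` a nonsingular form, closed-point sense).

Honest reading: closes no registered stub; for `n ≥ 4` the residual still contains the summit.
-/

set_option linter.dupNamespace false -- mandated namespace `Summit.<Summit>.<Problem>` of this single-conjunct summit

noncomputable section

open CategoryTheory CategoryTheory.Limits AlgebraicGeometry TopologicalSpace
open MvPolynomial
open Literature.AlgebraicGeometry.Resolution
open Literature.AlgebraicGeometry.Motives Literature.AlgebraicGeometry.Motives.SmoothHypersurface
open Literature.AlgebraicGeometry.Motives.ProjectiveSpace

namespace Summit.ResolutionOfSingularities.ResolutionOfSingularities.Cruxes.EquisingularLiftNat.Sections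

namespace CubicNodes

/-- ★ **`Theses.EquisingularLift.EquisingularLiftNat` (stmt-…-20038) RE-CUT BY NAME: off the submaximal codimension-2 linear subspaces AND off the
cubic surfaces with only ordinary singular points** (every characteristic). [OURS · lh8 · DEF-FREE · pure reduction]
[cite: Hartshorne1977, I Ex. 5.8, I Ex. 5.12] -/
theorem equisingularLiftNat_of_forall_elnatO_off_submaxLinN_cubicOrdinary
    (h : ∀ p : ℕ, p.Prime → ∀ (k : Type) [Field k] [CharP k p] [IsAlgClosed k] (n : ℕ) (H : Scheme.{0})
      (ι : H ⟶ (Literature.AlgebraicGeometry.Motives.projectiveSpace n k).left), IsClosedImmersion ι → IsIntegral H →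
      (∀ y : (Literature.AlgebraicGeometry.Motives.projectiveSpace n k).left,
        ∃ U : (Literature.AlgebraicGeometry.Motives.projectiveSpace n k).left.affineOpens,
          y ∈ (U : (Literature.AlgebraicGeometry.Motives.projectiveSpace n k).left.Opens) ∧ (ι.ker.ideal U).IsPrincipal) →
      3 ≤ n → ¬ Scheme.IsRegular H → ∀ (e : ℕ) (F : MvPolynomial (Fin (n + 1)) k), 3 ≤ e → F.IsHomogeneous e → Prime F →
      (letI := MvPolynomial.gradedAlgebra (σ := Fin (n + 1)) (R := k)
       Set.range ι = {x : Proj (homogeneousSubmodule (Fin (n + 1)) k) | F ∈ x.asHomogeneousIdeal}) →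
      (∀ (τ τ' : Fin (n + 1) → MvPolynomial (Fin (n + 1)) k) (d : ℕ),
        (∀ i, (τ i).IsHomogeneous 1) → (∀ i, (τ' i).IsHomogeneous 1) → (∀ i, aeval τ (τ' i) = X i) → (∀ i, aeval τ' (τ i) = X i) →
        (aeval τ' F).IsHomogeneous (d + 2) →
        aeval τ' F ∉ (Ideal.span {(X ⟨n - 1, by omega⟩ : MvPolynomial (Fin (n + 1)) k), X ⟨n, by omega⟩}) ^ (d + 1)) →
      (∀ hn : n = 3, e = 3 → ∃ (b : Fin (n + 1) → k) (c₀ : Fin (n + 1)), b c₀ = 1 ∧ eval b F = 0 ∧ (∀ j, eval b (pderiv j F) = 0) ∧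
        ∀ (μ : ℕ) (Φ Ψ : MvPolynomial (Fin n) k), 1 ≤ μ → Φ.IsHomogeneous μ →
          (∀ z : Fin n → k, z ≠ 0 → eval z Φ = 0 → ∃ j, eval z (pderiv j Φ) ≠ 0) →
          Ψ ∈ Ideal.span (Set.range (X : Fin n → MvPolynomial (Fin n) k)) ^ (μ + 1) →
          aeval (fun j : Fin n => (X j : MvPolynomial (Fin n) k) + C (b (c₀.succAbove j))) (ProjectiveSpace.dehomogenize k c₀ F) ≠ Φ + Ψ) →
      ELNatConclusionO k n H ι) :
    Summit.ResolutionOfSingularities.ResolutionOfSingularities.Theses.EquisingularLift.EquisingularLiftNat := by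
  refine SubmaxLinN.equisingularLiftNat_of_forall_elnatO_off_submaxLinN ?_
  intro p hp k _ _ _ n H ι hι hH hloc hn hreg e F he hF hprime hrange hsubmax
  by_cases hgood : ∃ (hn : n = 3), e = 3 ∧ ∀ (b : Fin (n + 1) → k) (c₀ : Fin (n + 1)), b c₀ = 1 → eval b F = 0 →
      (∀ j, eval b (pderiv j F) = 0) →
      ∃ (μ : ℕ) (Φ Ψ : MvPolynomial (Fin n) k), 1 ≤ μ ∧ Φ.IsHomogeneous μ ∧
        (∀ z : Fin n → k, z ≠ 0 → eval z Φ = 0 → ∃ j, eval z (pderiv j Φ) ≠ 0) ∧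
        Ψ ∈ Ideal.span (Set.range (X : Fin n → MvPolynomial (Fin n) k)) ^ (μ + 1) ∧
        aeval (fun j : Fin n => (X j : MvPolynomial (Fin n) k) + C (b (c₀.succAbove j))) (ProjectiveSpace.dehomogenize k c₀ F) = Φ + Ψ
  · obtain ⟨rfl, rfl, hall⟩ := hgood
    haveI := hι
    refine RouteCurrency.elnatO_of_elNatAt p hp k (1 + 1 + 1) H ι hι hH
      (elNatAt_of_cubic_ordinary (K := k) p hp ι F hF hprime hrange fun b c₀ hb1 hb0 hbd => ?_)
    obtain ⟨μ, Φ, Ψ, h1, h2, h3, h4, h5⟩ := hall b c₀ hb1 hb0 hbd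
    exact ⟨μ, Φ, Ψ, h1, h2, isNonsingularForm_of_forall_exists_eval_pderiv_ne_zero h3, h4, h5⟩
  · refine h p hp k n H ι hι hH hloc hn hreg e F he hF hprime hrange hsubmax fun hn3 he3 => ?_
    have hno : ¬ ∀ (b : Fin (n + 1) → k) (c₀ : Fin (n + 1)), b c₀ = 1 → eval b F = 0 → (∀ j, eval b (pderiv j F) = 0) →
        ∃ (μ : ℕ) (Φ Ψ : MvPolynomial (Fin n) k), 1 ≤ μ ∧ Φ.IsHomogeneous μ ∧
          (∀ z : Fin n → k, z ≠ 0 → eval z Φ = 0 → ∃ j, eval z (pderiv j Φ) ≠ 0) ∧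
          Ψ ∈ Ideal.span (Set.range (X : Fin n → MvPolynomial (Fin n) k)) ^ (μ + 1) ∧
          aeval (fun j : Fin n => (X j : MvPolynomial (Fin n) k) + C (b (c₀.succAbove j))) (ProjectiveSpace.dehomogenize k c₀ F) = Φ + Ψ :=
      fun hall => hgood ⟨hn3, he3, hall⟩
    push Not at hno
    obtain ⟨b, c₀, hb1, hb0, hbd, hnone⟩ := hno
    exact ⟨b, c₀, hb1, hb0, hbd, fun μ Φ Ψ h1 h2 h3 h4 => hnone μ Φ Ψ h1 h2 h3 h4⟩

end CubicNodes

end Summit.ResolutionOfSingularities.ResolutionOfSingularities.Cruxes.EquisingularLiftNat.Sections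

end
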